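import Mathlib
import Summits.Ventures.HodgeRepro0.P1LatticeIndexTwoExactHodge

/-!
# P1LatticeIndexTwoExactSigma — D13's THEOREM A (proofs/P1-FermatLatticeClosure-v1.2.md l.4, DECLARED STATUS l.4789) at its
INDEX-2 degrees: AOKI'S STANDARD ELEMENTS ARE HODGE MULTISETS, IN GENERAL — the last piece of the «L_M ⊆ H_M» half
(pub-hodge-repro0, p1 (g29), 2026-08-30), on the general lemmas of lean/P1LatticeIndexTwoExactHodge.lean.

Supporting artefact in the sense of ROUTE.md R-5 (finite combinatorics / exact arithmetic only; never the discharge of a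
Hodge-theoretic step; record-only).  THE STATEMENT (`sigma_isHodge`), for every M: for an odd prime p ∣ M and 1 ≤ i < M with
(M/p)/gcd(i, M/p) > 2 (which implies (M/p) ∤ i — all that is used), σ_{p,i} = {i, i + d, …, i + (p−1)·d, −p·i} (d = M/p; the
g28 artefact's `sigma M p i`) is a Hodge multiset of level M: its p + 1 entries are nonzero residues, and for every unit u
the residues u·(i + j·d) mod M, j < p, are exactly {r + j·d : j < p} with r = u·i mod d ≠ 0 (the affine map j ↦ (q + u·j)
mod p permutes ℤ/p: `sum_affine_mod`, by `Finset.sum_image` and the card argument; `mod_mul_add`: (k·d + r) mod (p·d) =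
(k mod p)·d + r), while u·(−p·i) ≡ M − p·r (the Hodge module's `mul_sub_mod`), so the weight at u is
d·p(p−1)/2 + p·r + (M − p·r) = M·(p+1)/2 (`Finset.sum_range_id_mul_two`).  Hence `isHodge_of_isBlock_general`: EVERY block
of the block set `IsBlock` is a Hodge multiset — with NO per-degree enumeration (the Hodge module's `checkSH` is not needed).
The per-degree corollaries (`L_le_H_M`, `L_eq_M`, `relindex_M`, `cosets_M` at the thirty degrees) are in
lean/P1LatticeIndexTwoExactIndexA.lean (33 … 87) and lean/P1LatticeIndexTwoExactIndexB.lean (88 … 119).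
NOT formalised: claim(·) for the blocks (Shioda 1981 Thm 4.3 / Lefschetz (1,1), Aoki 1987 Thm 2-1 / Thm 1-4); anything
Hodge-theoretic.
Nothing here asserts anything about whether the statement of README §1 has been proved elsewhere.
-/

namespace HodgeRepro0.P1.P1LatticeIndexTwoExact
open Matrix

/-- a list sum over `List.range` is a finset sum over `Finset.range` -/
theorem list_sum_range (g : ℕ → ℕ) : ∀ n, ((List.range n).map g).sum = ∑ j ∈ Finset.range n, g j
  | 0 => by simp
  | n + 1 => by
    rw [List.range_succ, List.map_append, List.sum_append, Finset.sum_range_succ, list_sum_range g n]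
    simp

/-- for r < d: (k·d + r) mod (p·d) = (k mod p)·d + r -/
theorem mod_mul_add (p d k r : ℕ) (hp : 0 < p) (hr : r < d) : (k * d + r) % (p * d) = (k % p) * d + r := by
  have hk : k = (k / p) * p + k % p := (Nat.div_add_mod' k p).symm
  have h1 : k * d + r = (p * d) * (k / p) + ((k % p) * d + r) := by
    calc k * d + r = ((k / p) * p + k % p) * d + r := by rw [← hk]
      _ = (p * d) * (k / p) + ((k % p) * d + r) := by ring
  rw [h1, Nat.mul_add_mod]
  apply Nat.mod_eq_of_lt
  have h2 : k % p < p := Nat.mod_lt _ hp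
  have h3 : (k % p) * d + r < (k % p) * d + d := by omega
  have h4 : (k % p) * d + d = (k % p + 1) * d := by ring
  have h5 : (k % p + 1) * d ≤ p * d := Nat.mul_le_mul_right d h2
  omega

/-- the affine map j ↦ (q + u·j) mod p permutes the residues mod p when u is prime to p -/
theorem sum_affine_mod (p q u : ℕ) (hp : 0 < p) (hu : Nat.Coprime u p) :
    ∑ j ∈ Finset.range p, (q + u * j) % p = ∑ k ∈ Finset.range p, k := by
  have hinj : ∀ j ∈ Finset.range p, ∀ j' ∈ Finset.range p, (q + u * j) % p = (q + u * j') % p → j = j' := by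
    intro j hj j' hj' h
    rw [Finset.mem_range] at hj hj'
    have h1 : q + u * j ≡ q + u * j' [MOD p] := h
    have h2 : u * j ≡ u * j' [MOD p] := Nat.ModEq.add_left_cancel' q h1
    have h3 : j ≡ j' [MOD p] := Nat.ModEq.cancel_left_of_coprime (by rw [Nat.coprime_comm] at hu; exact hu) h2
    exact Nat.ModEq.eq_of_lt_of_lt h3 hj hj'
  have himg : (Finset.range p).image (fun j => (q + u * j) % p) = Finset.range p := by
    apply Finset.eq_of_subset_of_card_le
    · intro x hx
      rw [Finset.mem_image] at hx
      obtain ⟨j, _, rfl⟩ := hx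
      exact Finset.mem_range.mpr (Nat.mod_lt _ hp)
    · rw [Finset.card_image_of_injOn hinj]
  conv_rhs => rw [← himg]
  rw [Finset.sum_image hinj]

/-- AOKI'S STANDARD ELEMENTS ARE HODGE MULTISETS: for an odd prime p ∣ M, 1 ≤ i < M with d ∤ i (d = M/p — implied by
(M/p)/gcd(i, M/p) > 2), σ_{p,i} = {i, i + d, …, i + (p−1)d, −p·i} is a Hodge multiset of level M: its p + 1 entries are
nonzero residues and, for every unit u, the residues u·(i + j·d) are {r + j·d : j < p} (r = u·i mod d ≠ 0) while
u·(−p·i) ≡ M − p·r, so the weight at u is d·p(p−1)/2 + p·r + (M − p·r) = M·(p+1)/2 -/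
theorem sigma_isHodge (M p i : ℕ) (hp : Nat.Prime p) (hodd : p % 2 = 1) (hdvd : M % p = 0) (hi0 : 0 < i) (hiM : i < M)
    (hg : 2 < (M / p) / Nat.gcd i (M / p)) : IsHodge M ((sigma M p i : List ℕ) : Multiset ℕ) := by
  have hp0 : 0 < p := hp.pos
  obtain ⟨d, hd⟩ : ∃ d, M = p * d := ⟨M / p, (Nat.mul_div_cancel' (Nat.dvd_of_mod_eq_zero hdvd)).symm⟩
  have hMp : M / p = d := by rw [hd, Nat.mul_div_cancel_left d hp0]
  rw [hMp] at hg
  have hd0 : 0 < d := by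
    rcases Nat.eq_zero_or_pos d with h | h
    · rw [h, Nat.mul_zero] at hd; omega
    · exact h
  have hM0 : 0 < M := by omega
  -- d ∤ i
  have hndvd : ¬ d ∣ i := by
    intro h
    have : Nat.gcd i d = d := Nat.gcd_eq_right h
    rw [this, Nat.div_self hd0] at hg
    omega
  -- the entries
  have hent : ∀ a ∈ sigma M p i, 0 < a ∧ a < M := by
    intro a ha
    simp only [sigma, List.mem_append, List.mem_map, List.mem_range, List.mem_singleton] at ha
    rcases ha with ⟨j, _, rfl⟩ | rfl
    · refine ⟨?_, Nat.mod_lt _ hM0⟩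
      rcases Nat.eq_zero_or_pos ((i + j * (M / p)) % M) with h | h
      · exfalso
        rw [hMp] at h
        have h1 : M ∣ i + j * d := Nat.dvd_of_mod_eq_zero h
        have h2 : d ∣ i + j * d := (Dvd.dvd.trans ⟨p, by rw [hd, Nat.mul_comm]⟩ h1)
        exact hndvd ((Nat.dvd_add_left (Dvd.intro_left j rfl)).mp h2)
      · exact h
    · have hA : 0 < (p * i) % M := by
        rcases Nat.eq_zero_or_pos ((p * i) % M) with h | h
        · exfalso
          have h1 : p * d ∣ p * i := by rw [← hd]; exact Nat.dvd_of_mod_eq_zero h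
          exact hndvd (Nat.dvd_of_mul_dvd_mul_left hp0 h1)
        · exact h
      have hAlt : (p * i) % M < M := Nat.mod_lt _ hM0
      rw [Nat.mod_eq_of_lt (by omega : M - (p * i) % M < M)]
      omega
  refine ⟨?_, ?_, ?_⟩
  · -- even cardinality
    simp only [Multiset.coe_card, sigma, List.length_append, List.length_map, List.length_range, List.length_singleton]
    rw [Nat.even_iff]
    omega
  · -- entries in [1, M−1]
    intro a ha
    exact hent a (Multiset.mem_coe.mp ha)
  · -- the weight at every unit
    intro u hu hcop
    rw [wt_coe, Multiset.coe_card]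
    simp only [sigma, List.length_append, List.length_map, List.length_range, List.length_singleton]
    rw [S_append]
    -- the first sum
    have hup : Nat.Coprime u p := by
      have : Nat.Coprime u M := hcop
      exact Nat.Coprime.coprime_dvd_right ⟨d, hd⟩ this
    set r := (u * i) % d with hr
    set q := (u * i) / d with hq
    have hui : u * i = q * d + r := (Nat.div_add_mod' (u * i) d).symm
    have hrd : r < d := Nat.mod_lt _ hd0
    have hr0 : 0 < r := by
      rcases Nat.eq_zero_or_pos r with h | h
      · exfalso
        have h1 : d ∣ u * i := Nat.dvd_of_mod_eq_zero h
        have hud : Nat.Coprime d u := by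
          have : Nat.Coprime u M := hcop
          exact (Nat.Coprime.coprime_dvd_right ⟨p, by rw [hd, Nat.mul_comm]⟩ this).symm
        exact hndvd (hud.dvd_of_dvd_mul_left h1)
      · exact h
    have hfirst : S M u ((List.range p).map (fun j => (i + j * (M / p)) % M)) =
        d * (∑ j ∈ Finset.range p, (q + u * j) % p) + p * r := by
      simp only [S, List.map_map, Function.comp_def]
      rw [list_sum_range]
      have e : ∀ j ∈ Finset.range p, (u * ((i + j * (M / p)) % M)) % M = ((q + u * j) % p) * d + r := by
        intro j _
        rw [hMp, Nat.mul_mod, Nat.mod_mod, ← Nat.mul_mod]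
        have : u * (i + j * d) = (q + u * j) * d + r := by
          calc u * (i + j * d) = u * i + (u * j) * d := by ring
            _ = (q + u * j) * d + r := by rw [hui]; ring
        rw [this, hd, mod_mul_add p d (q + u * j) r hp0 hrd]
      rw [Finset.sum_congr rfl e, Finset.sum_add_distrib, Finset.sum_const, Finset.card_range, smul_eq_mul,
        ← Finset.sum_mul]
      ring
    -- the last entry
    have hlast : S M u [(M - (p * i) % M) % M] = M - p * r := by
      simp only [S, List.map_cons, List.map_nil, List.sum_cons, List.sum_nil, Nat.add_zero]
      have hA : (p * i) % M = p * (i % d) := by rw [hd, Nat.mul_mod_mul_left]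
      have hA0 : 0 < p * (i % d) := by
        rcases Nat.eq_zero_or_pos (i % d) with h | h
        · exact absurd (Nat.dvd_of_mod_eq_zero h) hndvd
        · exact Nat.mul_pos hp0 h
      have hAM : p * (i % d) < M := by
        rw [hd]
        exact Nat.mul_lt_mul_of_pos_left (Nat.mod_lt _ hd0) hp0
      rw [hA, Nat.mod_eq_of_lt (by omega : M - p * (i % d) < M), mul_sub_mod M u (p * (i % d)) hcop ⟨hA0, hAM⟩]
      have : (u * (p * (i % d))) % M = p * r := by
        rw [hd, show u * (p * (i % d)) = p * (u * (i % d)) by ring, Nat.mul_mod_mul_left, hr, Nat.mul_mod, Nat.mod_mod,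
          ← Nat.mul_mod]
      rw [this]
    rw [hfirst, hlast, sum_affine_mod p q u hp0 hup]
    have hid := Finset.sum_range_id_mul_two p
    have hpr : p * r ≤ M := by
      rw [hd]
      exact Nat.mul_le_mul_left p hrd.le
    have hp1 : 1 ≤ p := hp0
    zify [hpr, hp1] at hid ⊢
    rw [hd]
    push_cast at hid ⊢
    linear_combination (d : ℤ) * hid

/-- EVERY BLOCK IS A HODGE MULTISET, IN GENERAL (the page's Lemma 1 (b) at the level M): the 4- and split 6-multisets by
definition, the σ_{p,i} by `sigma_isHodge` — no per-degree check -/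
theorem isHodge_of_isBlock_general (M : ℕ) (m : Multiset ℕ) (hm : IsBlock M m) : IsHodge M m := by
  rcases hm with ⟨_, hH⟩ | ⟨T₁, T₂, rfl, _, _, _, _, hH⟩ | ⟨p, i, hp, hodd, hdvd, hi0, hiM, hg, rfl⟩
  · exact hH
  · exact hH
  · exact sigma_isHodge M p i hp hodd hdvd hi0 hiM hg

end HodgeRepro0.P1.P1LatticeIndexTwoExact
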